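import Literature.Barriers.QuantumAdvantage.PBlockedSimSizeBound
import HarnessLib

/-!
# The `p`-blocked simulator in typed polynomial time, III: one round, the run, the decision

Topic `Literature/Barriers/QuantumAdvantage`; third file of the polynomial-time certificate (typed
`FP` algebra `CodeFP`) of the program `PSim` (`PBlockedSim.lean`), the classical machine of
Jozsa–Linden's lemma `ratpbl` / theorem `pblthm` (Proc. R. Soc. A 459 (2003), §3: "This gives a
classical simulation of the quantum algorithm using a number of rational arithmetic operations that
grows linearly with `j` … [hence] `poly(j)` elementary computational steps"). With the primitives of
`PSimFPTables.lean` and the size bound of `PBlockedSimSizeBound.lean`: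

* `foldBor_fp` — the union of the touched masks; **`roundSim_fp`** — one gate of the simulation on
  codes (context: the unary parameters `(N, W)`; the block bound `p` is fixed);
* the fold-size hypothesis of `CodeFP.foldl` for the run is the bound of `PBlockedSimSizeBound.lean`
  (`length_stE_foldl_roundSim_le`: on *every* input the code of the state after the gates processed so
  far is at most `(672 · 16^p + 34) (N + W + #gates + 1)^3`), dominated by a cubic in the length of the
  fold's input (`runBound_le_cube`);
* **`runSim_fp`**, `strToCfg_fp` (the input string as a coded bit list) and **`simDecide_codeFP`**:
  for every `p`, the decision bit `simDecide p W |x| m gates x` is computed in polynomial time from the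
  typed input `(W, m, gates, x)` coded by `simInE = pairE unE (pairE unE (pairE (rawE triE) strE))` —
  definitionally the format `inE` of `PBlockedSimDescription.lean`, which computes that input from the
  input string of a uniform family; the composition (membership in `FP`) lives in the follow-up file
  `PSimFPDecide.lean`, not here.

## References

* R. Jozsa, N. Linden, *On the role of entanglement in quantum-computational speed-up*, Proc. R. Soc.
  Lond. A 459 (2003) 2011–2032, arXiv:quant-ph/0201143: §3, proof of lemma `ratpbl` ("the total size
  of the description … grows only polynomially"; "poly(j) elementary computational steps"), theorem
  `pblthm`, lemma `ratlemma`.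
* S. Arora, B. Barak, *Computational Complexity: A Modern Approach*, CUP 2009, §1.3 (polynomially
  bounded loops), §6.2.
-/

noncomputable section

namespace Literature.Barriers.QuantumAdvantage

namespace PSim

open _root_.Computability Polynomial Literature.Computability.Complexity Literature.Computability.Complexity.CodeFP
  Literature.Computability.QuantumComplexity Literature.Computability.QuantumComplexity.ZWCode

/-! ### The union of the touched masks -/

/-- **The union mask of a block list on codes**: `(N, l) ↦ l.foldl (bor · ·.1) (zeros N)` (`N` unary).
[cite: JozsaLinden2003, §3 (proof of lemma ratpbl, Case 2: the qubits of B₁ ∪ B₂)] -/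
theorem foldBor_fp : CodeFP (pairE unE (rawE blkE)) cfgE (fun t => t.2.foldl (fun acc b => bor acc b.1) (zeros t.1)) := by
  have hstep : CodeFP (pairE unE (pairE blkE cfgE)) cfgE (fun t => bor t.2.2 t.2.1.1) :=
    (bor_fp.comp ((snd _ _).snd'.pair (snd _ _).fst'.fst') :)
  have h := (foldl (σ := ℕ) (α := Blk) (β := Cfg) (eσ := unE) (eα := blkE) (eβ := cfgE)
    (step := fun _ b acc => bor acc b.1) (init := fun N => zeros N) hstep zeros_fp (2 * X) (fun N l₁ l₂ => by
      simp only [eval_mul, eval_ofNat, eval_X, pairE_apply, length_boolPair, length_unE]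
      have := length_foldl_bor_le l₁ (zeros N)
      rw [length_zeros] at this
      rw [length_cfgE]
      omega) :)
  exact h.congr fun t => rfl

/-! ### One round on codes -/

/-- The input of a round: `((N, W), st, g)` (`N`, `W` unary). [folklore] -/
abbrev RoundIn : Type := (ℕ × ℕ) × (ℤ × List Blk) × (ℕ × ℕ × ℕ)

/-- Its code. [folklore] -/
abbrev roundInE : RoundIn → List Bool := pairE (pairE unE unE) (pairE stE triE)

/-- **One gate of the simulation on codes**: `((N, W), st, g) ↦ roundSim ⟨p, N, W⟩ st g`.
[cite: JozsaLinden2003, §3 (proof of lemma ratpbl, Cases 1 and 2: "requiring a constant number of arithmetic operations (which does not grow with j)")] -/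
theorem roundSim_fp (p : ℕ) : CodeFP roundInE stE (fun t => roundSim ⟨p, t.1.1, t.1.2⟩ t.2.1 t.2.2) := by
  have hN : CodeFP roundInE unE (fun t => t.1.1) := ((fst _ _).fst' :)
  have hW : CodeFP roundInE unE (fun t => t.1.2) := ((fst _ _).snd' :)
  have hst : CodeFP roundInE stE (fun t => t.2.1) := ((snd _ _).fst' :)
  have hD : CodeFP roundInE intE (fun t => t.2.1.1) := (hst.fst' :)
  have hblocks : CodeFP roundInE (rawE blkE) (fun t => t.2.1.2) := (hst.snd' :)
  have hg : CodeFP roundInE triE (fun t => t.2.2) := ((snd _ _).snd' :)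
  have hop : CodeFP roundInE natE (fun t => t.2.2.1) := (hg.fst' :)
  have htch : CodeFP roundInE (rawE blkE) (fun t => touchingL t.2.2.1 t.2.2.2.1 t.2.2.2.2 t.2.1.2) :=
    (touchingL_fp.comp (hg.pair hblocks) :)
  have hrest : CodeFP roundInE (rawE blkE) (fun t => untouchedL t.2.2.1 t.2.2.2.1 t.2.2.2.2 t.2.1.2) :=
    (untouchedL_fp.comp (hg.pair hblocks) :)
  have hC : CodeFP roundInE cfgE (fun t =>
      (touchingL t.2.2.1 t.2.2.2.1 t.2.2.2.2 t.2.1.2).foldl (fun acc b => bor acc b.1) (zeros t.1.1)) :=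
    (foldBor_fp.comp (hN.pair htch) :)
  have hlen : CodeFP roundInE natE (fun t => (touchingL t.2.2.1 t.2.2.2.1 t.2.2.2.2 t.2.1.2).length) :=
    ((natLength blkE).comp htch :)
  have hcond : CodeFP roundInE bitE (fun t => decide
      (((touchingL t.2.2.1 t.2.2.2.1 t.2.2.2.2 t.2.1.2).length = 1 ∨ (touchingL t.2.2.1 t.2.2.2.1 t.2.2.2.2 t.2.1.2).length = 2) ∧
        popcount ((touchingL t.2.2.1 t.2.2.2.1 t.2.2.2.2 t.2.1.2).foldl (fun acc b => bor acc b.1) (zeros t.1.1)) ≤ 2 * p)) :=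
    (((natEq.comp (hlen.pair (const _ 1))).or (natEq.comp (hlen.pair (const _ 2)))).and
      (natLe.comp ((popcount_fp.comp hC).pair (const _ (2 * p))))).congr fun t => by
        simp [Bool.decide_and, Bool.decide_or]
  have hkeys : CodeFP roundInE (rawE cfgE) (fun t =>
      subCfgs p ((touchingL t.2.2.1 t.2.2.2.1 t.2.2.2.2 t.2.1.2).foldl (fun acc b => bor acc b.1) (zeros t.1.1))) :=
    ((subCfgs_fp p).comp hC :)
  have hdef : CodeFP roundInE blkE (fun t => (zeros t.1.1, ([] : Tab))) := ((zeros_fp.comp hN).pair (const _ []) :)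
  have hb0 : CodeFP roundInE blkE (fun t => (touchingL t.2.2.1 t.2.2.2.1 t.2.2.2.2 t.2.1.2).getD 0 (zeros t.1.1, [])) :=
    ((rawGetOr blkE).comp (htch.pair ((const _ 0).pair hdef)) :)
  have hb1 : CodeFP roundInE blkE (fun t => (touchingL t.2.2.1 t.2.2.2.1 t.2.2.2.2 t.2.1.2).getD 1 (zeros t.1.1, [])) :=
    ((rawGetOr blkE).comp (htch.pair ((const _ 1).pair hdef)) :)
  have hmerge : CodeFP roundInE tabE (fun t => mergeTab t.1.2 t.2.1.1
      ((touchingL t.2.2.1 t.2.2.2.1 t.2.2.2.2 t.2.1.2).getD 0 (zeros t.1.1, [])).1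
      ((touchingL t.2.2.1 t.2.2.2.1 t.2.2.2.2 t.2.1.2).getD 0 (zeros t.1.1, [])).2
      ((touchingL t.2.2.1 t.2.2.2.1 t.2.2.2.2 t.2.1.2).getD 1 (zeros t.1.1, [])).1
      ((touchingL t.2.2.1 t.2.2.2.1 t.2.2.2.2 t.2.1.2).getD 1 (zeros t.1.1, [])).2
      (subCfgs p ((touchingL t.2.2.1 t.2.2.2.1 t.2.2.2.2 t.2.1.2).foldl (fun acc b => bor acc b.1) (zeros t.1.1)))) :=
    (mergeTab_fp.comp ((hW.pair hD).pair (hb0.pair (hb1.pair hkeys))) :)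
  have hTC : CodeFP roundInE tabE (fun t => if (touchingL t.2.2.1 t.2.2.2.1 t.2.2.2.2 t.2.1.2).length = 1 then
      ((touchingL t.2.2.1 t.2.2.2.1 t.2.2.2.2 t.2.1.2).getD 0 (zeros t.1.1, [])).2 else
      mergeTab t.1.2 t.2.1.1
        ((touchingL t.2.2.1 t.2.2.2.1 t.2.2.2.2 t.2.1.2).getD 0 (zeros t.1.1, [])).1
        ((touchingL t.2.2.1 t.2.2.2.1 t.2.2.2.2 t.2.1.2).getD 0 (zeros t.1.1, [])).2
        ((touchingL t.2.2.1 t.2.2.2.1 t.2.2.2.2 t.2.1.2).getD 1 (zeros t.1.1, [])).1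
        ((touchingL t.2.2.1 t.2.2.2.1 t.2.2.2.2 t.2.1.2).getD 1 (zeros t.1.1, [])).2
        (subCfgs p ((touchingL t.2.2.1 t.2.2.2.1 t.2.2.2.2 t.2.1.2).foldl (fun acc b => bor acc b.1) (zeros t.1.1)))) :=
    (iteP (natEq.comp (hlen.pair (const _ 1))) hb0.snd' hmerge :)
  have hT' := (gateTab_fp.comp ((hW.pair hg).pair (hkeys.pair hTC)) :)
  have hD' : CodeFP roundInE intE (fun t => if t.2.2.1 = 0 then t.2.1.1 + t.2.1.1 else t.2.1.1) :=
    (iteP (natEq.comp (hop.pair (const _ 0))) (intAdd.comp (hD.pair hD)) hD :)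
  have hdbl : CodeFP (pairE roundInE blkE) blkE (fun c => (c.2.1, doubleTab c.1.1.2 c.2.2)) :=
    ((snd _ _).fst'.pair (doubleTab_fp.comp ((hW.comp (fst _ _)).pair (snd _ _).snd')) :)
  have hrest' : CodeFP roundInE (rawE blkE) (fun t => if t.2.2.1 = 0 then
      (untouchedL t.2.2.1 t.2.2.2.1 t.2.2.2.2 t.2.1.2).map (fun b => (b.1, doubleTab t.1.2 b.2)) else
      untouchedL t.2.2.1 t.2.2.2.1 t.2.2.2.2 t.2.1.2) :=
    (iteP (natEq.comp (hop.pair (const _ 0))) ((map hdbl).comp ((CodeFP.id _).pair hrest)) hrest :)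
  have hnew := ((newBlocks_fp p).comp (hN.pair (hW.pair (hC.pair (hkeys.pair hT')))) :)
  have hthen := (hD'.pair ((rawAppend blkE).comp (hrest'.pair hnew)) :)
  exact (iteP hcond hthen hst).congr fun t => rfl

/-! ### The run on codes -/

/-- **The size bound of the run is dominated by a cubic in any common bound of `N`, `W`, `#gates`.**
[folklore] -/
theorem runBound_le_cube {N W n L : ℕ} (p : ℕ) (hN : N ≤ L) (hW : W ≤ L) (hn : n ≤ L) :
    (672 * 16 ^ p + 34) * (N + W + n + 1) ^ 3 ≤ 27 * (672 * 16 ^ p + 34) * (L + 1) ^ 3 := by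
  have h : N + W + n + 1 ≤ 3 * (L + 1) := by omega
  calc (672 * 16 ^ p + 34) * (N + W + n + 1) ^ 3 ≤ (672 * 16 ^ p + 34) * (3 * (L + 1)) ^ 3 :=
        Nat.mul_le_mul_left _ (Nat.pow_le_pow_left h 3)
    _ = 27 * (672 * 16 ^ p + 34) * (L + 1) ^ 3 := by ring

/-- The context of the run: `((N, W), w₀)`. [folklore] -/
abbrev RunS : Type := (ℕ × ℕ) × Cfg

/-- Its code. [folklore] -/
abbrev runSE : RunS → List Bool := pairE (pairE unE unE) cfgE

/-- **The whole run on codes**: `(((N, W), w₀), gates) ↦ runSim ⟨p, N, W⟩ w₀ gates`, by `CodeFP.foldl`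
with the cubic bound on the code of the state along the run (`length_stE_foldl_roundSim_le` of
`PBlockedSimSizeBound.lean`, on every input). [cite: JozsaLinden2003, §3 (proof of lemma ratpbl: "a number of rational arithmetic operations that grows linearly with j … poly(j) elementary computational steps")] -/
theorem runSim_fp (p : ℕ) : CodeFP (pairE runSE (rawE triE)) stE (fun t => runSim ⟨p, t.1.1.1, t.1.1.2⟩ t.1.2 t.2) := by
  have hstep : CodeFP (pairE runSE (pairE triE stE)) stE (fun t => roundSim ⟨p, t.1.1.1, t.1.1.2⟩ t.2.2 t.2.1) :=
    ((roundSim_fp p).comp ((fst _ _).fst'.pair ((snd _ _).snd'.pair (snd _ _).fst')) :)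
  have hinit : CodeFP runSE stE (fun s => ((1 : ℤ), initBlocks s.1.1 s.2)) :=
    ((const _ (1 : ℤ)).pair (initBlocks_fp.comp ((fst _ _).fst'.pair (snd _ _))) :)
  have h := (foldl (σ := RunS) (α := ℕ × ℕ × ℕ) (β := ℤ × List Blk) (eσ := runSE) (eα := triE) (eβ := stE)
    (step := fun s g st => roundSim ⟨p, s.1.1, s.1.2⟩ st g) (init := fun s => (1, initBlocks s.1.1 s.2)) hstep hinit
    (Polynomial.C (27 * (672 * 16 ^ p + 34)) * (X + 1) ^ 3) (fun s l₁ l₂ => by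
      obtain ⟨⟨N, W⟩, w₀⟩ := s
      refine (length_stE_foldl_roundSim_le p N W w₀ l₁).trans ?_
      simp only [eval_mul, eval_C, eval_pow, eval_add, eval_X, eval_one]
      set L := (pairE runSE (rawE triE) (((N, W), w₀), l₁ ++ l₂)).length with hL
      have hL' : L = 2 * (2 * (2 * N + 2 + W) + 2 + 4 * w₀.length) + 2 + (rawE triE (l₁ ++ l₂)).length := by
        rw [hL, pairE_apply, length_boolPair, show runSE ((N, W), w₀) = boolPair (boolPair (unE N) (unE W)) (cfgE w₀) from rfl,
          length_boolPair, length_boolPair, length_unE, length_unE, length_cfgE]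
      have hn : l₁.length ≤ L := by
        have := length_le_length_rawE triE (l₁ ++ l₂)
        rw [List.length_append] at this
        omega
      exact runBound_le_cube p (by omega) (by omega) hn) :)
  exact h.congr fun t => rfl

/-! ### The decision from the typed input -/

/-- **The input string as a coded bit list** (`strE ↦ cfgE`): cutting into blocks of length one.
[folklore] -/
theorem strToCfg_fp : CodeFP strE cfgE (fun x => x) := by
  have h := (strChunks.comp (strLength.pair ((const strE 1).pair (CodeFP.id strE))) :)
  refine h.recodeOut fun x => ?_
  simp only [id]
  have hchunks : (List.range x.length).map (fun i => (x.drop (i * 1)).take 1) = x.map fun b => [b] := by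
    apply List.ext_getElem
    · simp
    · intro i h1 h2
      rw [List.length_map, List.length_range] at h1
      rw [List.getElem_map, List.getElem_range, List.getElem_map, Nat.mul_one, List.take_one_drop_eq_of_lt_length h1]
      rfl
  rw [hchunks]
  simp only [rawE, strE, List.map_map]
  congr 1

/-- The code of the simulator's typed input `(W, m, gates, x)`: the width and the ancilla count in
unary, the raw list of gate triples, the input string verbatim (the format `inE` of
`PBlockedSimDescription.lean`). [folklore] -/
abbrev simInE : ℕ × ℕ × List (ℕ × ℕ × ℕ) × List Bool → List Bool :=
  pairE unE (pairE unE (pairE (rawE triE) strE))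

/-- **The decision bit of the simulation is computed in polynomial time from the typed input**
`(W, m, gates, x)`, for every fixed block bound `p`: `(W, m, gates, x) ↦ simDecide p W |x| m gates x`.
[cite: JozsaLinden2003, §3 (theorem pblthm; proof of lemma ratpbl: "giving an efficient classical computation")] -/
theorem simDecide_codeFP (p : ℕ) : CodeFP simInE bitE (fun t => simDecide p t.1 t.2.2.2.length t.2.1 t.2.2.1 t.2.2.2) := by
  have hW : CodeFP simInE unE (fun t => t.1) := (fst _ _ :)
  have hm : CodeFP simInE unE (fun t => t.2.1) := ((snd _ _).fst' :)
  have hgs : CodeFP simInE (rawE triE) (fun t => t.2.2.1) := ((snd _ _).snd'.fst' :)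
  have hx : CodeFP simInE strE (fun t => t.2.2.2) := ((snd _ _).snd'.snd' :)
  have hN : CodeFP simInE unE (fun t => t.2.2.2.length + t.2.1) := (unAdd.comp ((strLength.comp hx).pair hm) :)
  have hw : CodeFP simInE cfgE (fun t => t.2.2.2 ++ zeros t.2.1) :=
    ((rawAppend bitE).comp ((strToCfg_fp.comp hx).pair (zeros_fp.comp hm)) :)
  have hrun : CodeFP simInE stE (fun t => runSim ⟨p, t.2.2.2.length + t.2.1, t.1⟩ (t.2.2.2 ++ zeros t.2.1) t.2.2.1) :=
    ((runSim_fp p).comp (((hN.pair hW).pair hw).pair hgs) :)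
  exact (((readout_fp p).comp ((hN.pair hW).pair hrun)).congr fun t => rfl)

end PSim

end Literature.Barriers.QuantumAdvantage

end
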